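import Literature.IUT.HodgeTheaters.GlobalFrobenioidsCoricRigidityFieldLevel
import Literature.IUT.HodgeTheaters.GlobalFrobenioidsCyclotomeRigidityZHat
import Literature.IUT.HodgeTheaters.GlobalFrobenioidsKummer
import HarnessLib

/-!
# [IUTchI] Example 5.1 (v), p. 128 l. 1–12 — the one-layer cyclotome display `UniqueCyclotomeIso` (FACT-LIST
# F-2582, sub-DAG row E51/L27) AT THE GENUINE ∞κ KUMMER CONTAINER of the Ex. 5.1 (i) data (proof-only)

S. Mochizuki, *Inter-universal Teichmüller theory I*, kurims manuscript (May 2020), §5 Example 5.1 (v), p. 127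
l. 75 – p. 128 l. 12 ([IUTchI] Ex 5.1 (v) pp.127–128) [claim: Mochizuki2012, status: disputed]: "by considering
the Kummer classes ⊆ `lim_{→ H} H¹(H, μ_Ẑ(†𝕄^⊛_∞κ))` … there exists a unique isomorphism of cyclotomes
`μ^Θ_Ẑ(π₁(†𝒟^⊚)) ⥲ μ_Ẑ(†𝕄^⊛_∞κ)` such that the resulting isomorphism between direct limits of cohomology
modules induces an isomorphism `𝕄^⊛_∞κ(†𝒟^⊚) ⥲ †𝕄^⊛_∞κ`" — uniqueness "by considering divisors of zeroes and
poles [Rmk 3.1.7 (i)] associated to Kummer classes of rational functions as in [AbsTopIII] Prop. 1.6 (iii), from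
the elementary observation that, relative to the natural inclusion `ℚ ↪ Ẑ ⊗ ℚ`, `ℚ_{>0} ∩ Ẑ^× = {1}`".
LANA §6.1 pp. 31–32 [LANA2026Report]: the Kummer container `lim_{→ H} H¹(H, Λ(A))` and its `Ẑ^×`-module structure.

Cell abc-iut, block C / F fact-proving wave, tranche 190 (abc-iut-f-190), FACT-LIST row **F-2582**
`Literature.IUT.HodgeTheaters.UniqueCyclotomeIso` — a SCHEMA over abc-iut-L5-t1's free record `CyclotomeComparison`
(universal closure REFUTED in tree: `exists_not_uniqueCyclotomeIso_valuationToy`, abc-iut-w4-d068; closer of record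
from the printed laws: `UniqueCyclotomeIso.of_laws`, abc-iut-w5-d110 p424820; model witnesses at the real torsor
`Ẑ^×`: abc-iut-f-189 p433690).  The cone consumer is conjunct E51/L27 of the LAYER-5 certificate
(`Summit.ABC.IUTFork.Conditional.layer5_held_ex51v_v3`, `Conditional/Layer5OfSV03.lean`), where it is derived by
`of_laws` over FREE data `C, zμ, twist, ordC` and SIX law binders `h_Ex51v_zμ_one / _E / _T / _D / _Ctwo / _Cone`.

**What this file proves (PROOF-ONLY: no `def`, no `instance`, no new `Prop` fact).**  `UniqueCyclotomeIso` for the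
GENUINE comparison datum of the Ex. 5.1 (i) data `N : NFBridgeRecon` — both cyclotomes := the tree's cyclotome
`Λ(K_rat^×)` (`cyclotome N.Kratˣ`; at the model `†𝕄^⊛_∞κ = 𝕄^⊛_∞κ(†𝒟^⊚) ⊆ K_rat`, so `μ_Ẑ(†𝕄^⊛_∞κ) = Λ(K_rat^×)`,
and `μ^Θ_Ẑ(π₁(†𝒟^⊚))` is read through its cyclotomic-rigidity identification with `Λ(K_rat^×)`, [AbsTopIII]
Thm 1.9 (d)/(e) — the identification under which `𝕄^⊛_∞κ(†𝒟^⊚)` IS the Kummer image), both containers := the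
GENUINE `lim_{→ i} H¹(S i, Λ(K_rat^×))` (L2 `H1Colimit`), both subsets := the genuine Kummer classes
`κ(𝕄^⊛_∞κ)` (L2 `kummerMap`), and the map induced by a cyclotome isomorphism `e` := the container map it induces on
cohomology, i.e. the twist `H1ColimTwist S hS (χ e)` by its cyclotomic character `χ : Aut(Λ(K_rat^×)) ⥲ Ẑ^×`
(abc-iut-w4-d056's `cyclotome.zhatTwist_bijective`: `Aut(Λ(R^×)) = Ẑ^×` on the nose, so print's law (T) "`Aut(μ_Ẑ) =
Ẑ^×` + functoriality of `lim_{→} H¹` in the coefficients" is a THEOREM here, not a binder):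

* `NFBridgeRecon.fixed_of_kummerMap_eq_H1ColimTwist` — if `κ(f′) = u · κ(f)` with `f` `π₁^rat`-fixed, then `f′` is
  `π₁^rat`-fixed (equivariance of `κ`, the twists commute with the Galois action, injectivity of `κ`);
* `NFBridgeRecon.uniqueCyclotomeIso_infκ_kummerMap` — **E51/L27 at the genuine container** over any directed
  exhaustive system `S` of normal subgroups, from: `hcoe`, `hprim`, injectivity of `κ` (E51/L26), law (b′) `hord`
  at the genuine Kummer classes ([AbsTopIII] Prop. 1.6 (iii)), Rmk 3.1.7 (i)/(ii) `hpole`/`hex` — the binders of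
  abc-iut-w4-d056's `existsUniqueCoricStructure_infκPair_kummerMap` (conjunct 1), nothing else;
* `…_of_ordHom` ((b′) from (o) additivity of `ord_x` on fixed functions + finite index, via
  `kummerMap_hord_of_ordHom_of_subset`), `…_of_ordHom_of_fixedRoots` (injectivity from (iv) `hdiv`),
  `…_canonical` (levels := ALL open normal subgroups of `π₁^rat`), and `…_fieldLevel` (units action := Mathlib's
  `Units.mulDistribMulActionRight`, rootability from `hrootU`; binders `hrootU hprim hdiv ord hordmul hpole hex` =
  those of conjunct 1's field-level closer `existsUniqueCoricStructure_infκPair_fieldLevel`, p436822, minus `h1`/`hpow`;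
  `units_pow_surjective_of_roots` converts that closer's `hroot` into `hrootU`); helper `smul_mk0_of_fixed`.

USE (LAYER-5 certificate, a later version, writer's call): SPECIALISE the free data `(C, zμ, twist, ordC)` of
conjunct E51/L27 to this genuine datum and DROP the six E51/L27 law binders — the conjunct then follows from the
binders conjunct 1 already carries.  The unique isomorphism is the identity of `Λ(K_rat^×)` [i.e. the rigidity
identification itself]; the content is the uniqueness ("`ℚ_{>0} ∩ Ẑ^× = {1}`", `CyclotomeRigidity.eq_one_of_two_zeros_one_pole`).
HONEST FRAMING: a kernel theorem about OUR typed interface `NFBridgeRecon` at OUR genuine Kummer container; the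
"respectively `∞κ×`" and `†𝕄^⊛` (E51/L28) clauses are not covered here; no side is taken on [IUTchIII] Cor. 3.12;
nothing of the disputed series is asserted; typed ≠ proved; instantiated ≠ endorsed.
-/

namespace Literature.IUT.HodgeTheaters

open ProfiniteGrp ProfiniteGrp.ProfiniteCompletion
open Literature.AnabelianGeometry.EtaleTheta Literature.AnabelianGeometry.EtaleTheta.ZHatLevel

namespace NFBridgeRecon

section Levels

variable (N : NFBridgeRecon.{0}) [MulDistribMulAction N.piRat N.Kratˣ] {ι : Type} [Preorder ι]
  [DecidableEq ι] [IsDirectedOrder ι] [Nonempty ι] (S : ι → Subgroup N.piRat)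
  (hS : ∀ ⦃i j : ι⦄, i ≤ j → S j ≤ S i) [hN : ∀ i, (S i).Normal] [RootableBy N.Kratˣ ℕ]

omit [RootableBy N.Kratˣ ℕ] in
/-- A `π₁^rat`-fixed nonzero rational function gives a `π₁^rat`-fixed unit (units action compatible with the field
action). ([IUTchI] Ex 5.1 (v) p.127) [claim: Mochizuki2012, status: disputed] -/
theorem smul_mk0_of_fixed
    (hcoe : ∀ (g : N.piRat) (a : N.Kratˣ), ((g • a : N.Kratˣ) : N.Krat) = g • (a : N.Krat))
    {f : N.Krat} (hf0 : f ≠ 0) (hf : ∀ g : N.piRat, g • f = f) (g : N.piRat) :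
    g • Units.mk0 f hf0 = Units.mk0 f hf0 :=
  Units.ext (by rw [hcoe, Units.val_mk0, hf g])

/-- **A Kummer class in the `Ẑ^×`-orbit of the class of a FIXED function is the class of a fixed function**: if
`κ(f′) = u · κ(f)` at the genuine Kummer map with `f ∈ K_rat^×` fixed by `π₁^rat`, then `f′` is fixed by `π₁^rat` —
because `κ` is `π₁^rat`-equivariant (`conjColimEquiv_kummerMap`), the twists `u ·` commute with the Galois action
on the container (`H1ColimTwist_conjColimMap`), and `κ` is injective (E51/L26).  PROVED.
([IUTchI] Ex 5.1 (v) p.127) [claim: Mochizuki2012, status: disputed] -/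
theorem fixed_of_kummerMap_eq_H1ColimTwist (hc : IsExhausted N.Kratˣ S)
    (hinj : Function.Injective (kummerMap hS hc))
    (u : MulAut (completion (GrpCat.of (Multiplicative ℤ)))) {a a' : N.Kratˣ}
    (ha : ∀ g : N.piRat, g • a = a)
    (h : kummerMap hS hc a' = H1ColimTwist S hS u (kummerMap hS hc a)) (g : N.piRat) : g • a' = a' := by
  apply hinj
  rw [← CoMorphism.conjColimEquiv_kummerMap S hS hc g a', CoMorphism.conjColimEquiv_apply, h,
    ← H1ColimTwist_conjColimMap S hS u g, ← CoMorphism.conjColimEquiv_apply,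
    CoMorphism.conjColimEquiv_kummerMap S hS hc g a, ha g]

/-- **[IUTchI] Ex. 5.1 (v), p. 128 l. 1–12 (E51/L27; FACT-LIST F-2582 `UniqueCyclotomeIso`) AT THE GENUINE ∞κ
KUMMER CONTAINER.**  For the Ex. 5.1 (i) data `N` (universe `0`), any units action compatible with the field action
(`hcoe`), any directed exhaustive system `S` of normal subgroups of `π₁^rat` [the open normal subgroups], `K_rat`
with a primitive `n`-th root of unity for every `n` and `K_rat^×` rootable: consider the comparison datum whose two
cyclotomes are `Λ(K_rat^×)`, whose two containers are `lim_{→ i} H¹(S i, Λ(K_rat^×))`, whose two subsets are the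
Kummer classes of the ∞κ-coric functions `κ(𝕄^⊛_∞κ)`, and whose induced map of an isomorphism of cyclotomes `e` is
the container twist by its cyclotomic character `χ(e) ∈ Ẑ^× = Aut(Λ(K_rat^×))`.  IF the Kummer map is injective
(E51/L26), (b′) `Ẑ^×` acts by multiplication on the divisors of `π₁^rat`-fixed ∞κ-coric functions whose genuine
Kummer classes it relates ([AbsTopIII] Prop. 1.6 (iii)), and Rmk 3.1.7 (i)/(ii) hold in divisor form (`hpole`: a
fixed ∞κ-coric function has at most one pole; `hex`: some fixed ∞κ-coric function has two distinct zeroes), THEN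
there is EXACTLY ONE isomorphism of cyclotomes inducing `κ(𝕄^⊛_∞κ) ⥲ κ(𝕄^⊛_∞κ)` — the identity.  PROVED; law (T) is
the theorem `cyclotome.zhatTwist_bijective`, "`ℚ_{>0} ∩ Ẑ^× = {1}`" is `CyclotomeRigidity.eq_one_of_two_zeros_one_pole`.
([IUTchI] Ex 5.1 (v) p.128) [claim: Mochizuki2012, status: disputed] -/
theorem uniqueCyclotomeIso_infκ_kummerMap
    (hcoe : ∀ (g : N.piRat) (a : N.Kratˣ), ((g • a : N.Kratˣ) : N.Krat) = g • (a : N.Krat))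
    (hprim : ∀ n : ℕ, 0 < n → ∃ ζ : N.Krat, IsPrimitiveRoot ζ n) (hc : IsExhausted N.Kratˣ S)
    (hinj : Function.Injective (kummerMap hS hc))
    {X : Type*} (ord : X → N.Krat → ℤ)
    (hord : ∀ (u : MulAut (completion (GrpCat.of (Multiplicative ℤ)))) (f f' : N.infκPair.carrier),
      (∀ g : N.piRat, g • (f : N.Krat) = f) → (∀ g : N.piRat, g • (f' : N.Krat) = f') →
      kummerMap hS hc (Units.mk0 (f' : N.Krat) (N.coe_infκPair_ne_zero f')) =
        H1ColimTwist S hS u (kummerMap hS hc (Units.mk0 (f : N.Krat) (N.coe_infκPair_ne_zero f))) →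
      ∀ x : X, u (eta (ord x f)) = eta (ord x f'))
    (hpole : ∀ f' ∈ N.Minfκ, (∀ g : N.piRat, g • f' = f') →
      ∀ x₁ x₂ : X, x₁ ≠ x₂ → ¬ (ord x₁ f' < 0 ∧ ord x₂ f' < 0))
    (hex : ∃ f ∈ N.Minfκ, (∀ g : N.piRat, g • f = f) ∧
      ∃ x₁ x₂ : X, x₁ ≠ x₂ ∧ 0 < ord x₁ f ∧ 0 < ord x₂ f) :
    UniqueCyclotomeIso
      { μ₁ := cyclotome N.Kratˣ
        μ₂ := cyclotome N.Kratˣ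
        H₁ := H1Colimit N.Kratˣ S hS
        H₂ := H1Colimit N.Kratˣ S hS
        im₁ := Set.range fun f : N.infκPair.carrier =>
          kummerMap hS hc (Units.mk0 (f : N.Krat) (N.coe_infκPair_ne_zero f))
        im₂ := Set.range fun f : N.infκPair.carrier =>
          kummerMap hS hc (Units.mk0 (f : N.Krat) (N.coe_infκPair_ne_zero f))
        induced := fun e => H1ColimTwist S hS
          ((Equiv.ofBijective _ (cyclotome.zhatTwist_bijective (R := N.Krat) hprim)).symm e) } := by
  -- the cyclotomic character `χ : Aut(Λ(K_rat^×)) ⥲ Ẑ^×`, inverse to `zhatTwist`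
  set χ := (Equiv.ofBijective _ (cyclotome.zhatTwist_bijective (R := N.Krat) hprim)).symm with hχ
  have hχ_twist : ∀ e : cyclotome N.Kratˣ ≃* cyclotome N.Kratˣ, cyclotome.zhatTwist N.Kratˣ (χ e) = e :=
    fun e => Equiv.ofBijective_apply_symm_apply _ _ e
  have hχ_one : χ 1 = 1 := by
    rw [hχ, Equiv.symm_apply_eq]
    exact (map_one (cyclotome.zhatTwist N.Kratˣ)).symm
  refine ⟨⟨1, ?_, fun e he => ?_⟩⟩
  · -- EXISTENCE: the identity induces the identity of the container
    change Set.BijOn (fun z => H1ColimTwist S hS (χ 1) z) _ _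
    refine (Set.bijOn_id _).congr fun z _ => ?_
    change z = H1ColimTwist S hS (χ 1) z
    rw [hχ_one, H1ColimTwist_one_apply]
  · -- UNIQUENESS: `e = zhatTwist u`; `u ·` preserves `κ(𝕄^⊛_∞κ)`; divisors force `u = 1`
    change Set.BijOn (fun z => H1ColimTwist S hS (χ e) z) _ _ at he
    obtain ⟨f, hfM, hf, x₁, x₂, hne, h₁, h₂⟩ := hex
    -- the class of the fixed function `f` with two zeroes is carried into `κ(𝕄^⊛_∞κ)`
    obtain ⟨F', hF'⟩ := he.mapsTo (Set.mem_range_self (⟨f, hfM⟩ : N.infκPair.carrier))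
    -- `F'` is fixed by `π₁^rat`
    have hF'fix : ∀ g : N.piRat, g • (F' : N.Krat) = F' := fun g => by
      have hu := N.fixed_of_kummerMap_eq_H1ColimTwist S hS hc hinj (χ e)
        (N.smul_mk0_of_fixed hcoe (N.coe_infκPair_ne_zero (⟨f, hfM⟩ : N.infκPair.carrier)) hf) hF' g
      have hval := congrArg Units.val hu
      rwa [hcoe, Units.val_mk0] at hval
    -- divisor transport at `f ↦ F'`, and "`ℚ_{>0} ∩ Ẑ^× = {1}`"
    have hd := hord (χ e) ⟨f, hfM⟩ F' hf hF'fix hF'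
    have hu1 : χ e = 1 :=
      CyclotomeRigidity.eq_one_of_two_zeros_one_pole (χ e) h₁ h₂ (hpole F' F'.2 hF'fix x₁ x₂ hne) (hd x₁) (hd x₂)
    rw [← hχ_twist e, hu1, map_one]

/-- **E51/L27 at the genuine container with (b′) from the ADDITIVITY OF `ord_x` on `π₁^rat`-fixed nonzero rational
functions (o)** (and the finite index of the levels; abc-iut-w4-d056's `kummerMap_hord_of_ordHom_of_subset`, over
abc-iut-w4-d057's coset-product norm): hypotheses `hcoe hprim`, injectivity of `κ` (E51/L26), `hfi`, (o) `hordmul`,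
Rmk 3.1.7 (i)/(ii) `hpole`/`hex`.  PROVED. ([IUTchI] Ex 5.1 (v) p.128) [claim: Mochizuki2012, status: disputed] -/
theorem uniqueCyclotomeIso_infκ_of_ordHom
    (hcoe : ∀ (g : N.piRat) (a : N.Kratˣ), ((g • a : N.Kratˣ) : N.Krat) = g • (a : N.Krat))
    (hprim : ∀ n : ℕ, 0 < n → ∃ ζ : N.Krat, IsPrimitiveRoot ζ n) (hc : IsExhausted N.Kratˣ S)
    (hfi : ∀ i, (S i).FiniteIndex) (hinj : Function.Injective (kummerMap hS hc))
    {X : Type*} (ord : X → N.Krat → ℤ)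
    (hordmul : ∀ (x : X) (a b : N.Krat), a ≠ 0 → b ≠ 0 → (∀ g : N.piRat, g • a = a) → (∀ g : N.piRat, g • b = b) →
      ord x (a * b) = ord x a + ord x b)
    (hpole : ∀ f' ∈ N.Minfκ, (∀ g : N.piRat, g • f' = f') →
      ∀ x₁ x₂ : X, x₁ ≠ x₂ → ¬ (ord x₁ f' < 0 ∧ ord x₂ f' < 0))
    (hex : ∃ f ∈ N.Minfκ, (∀ g : N.piRat, g • f = f) ∧
      ∃ x₁ x₂ : X, x₁ ≠ x₂ ∧ 0 < ord x₁ f ∧ 0 < ord x₂ f) :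
    UniqueCyclotomeIso
      { μ₁ := cyclotome N.Kratˣ
        μ₂ := cyclotome N.Kratˣ
        H₁ := H1Colimit N.Kratˣ S hS
        H₂ := H1Colimit N.Kratˣ S hS
        im₁ := Set.range fun f : N.infκPair.carrier =>
          kummerMap hS hc (Units.mk0 (f : N.Krat) (N.coe_infκPair_ne_zero f))
        im₂ := Set.range fun f : N.infκPair.carrier =>
          kummerMap hS hc (Units.mk0 (f : N.Krat) (N.coe_infκPair_ne_zero f))
        induced := fun e => H1ColimTwist S hS
          ((Equiv.ofBijective _ (cyclotome.zhatTwist_bijective (R := N.Krat) hprim)).symm e) } :=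
  N.uniqueCyclotomeIso_infκ_kummerMap S hS hcoe hprim hc hinj ord
    (fun u f f' hf hf' h x => N.kummerMap_hord_of_ordHom_of_subset N.Minfκ _ S hS
      (fun h0 => N.zero_notMem (N.minfκ_subset h0)) hcoe hc hfi ord hordmul u f f' hf hf' h x) hpole hex

include hS in
/-- **E51/L27 at the genuine container, modulo laws of the genuine Galois action only**: as `…_of_ordHom` with the
injectivity of `κ` replaced by (iv) `hdiv` — no `S i`-invariant unit other than `1` has `S i`-invariant roots of all
orders (E51/L26 via `kummerMapHom_injective_of`).  PROVED. ([IUTchI] Ex 5.1 (v) p.128)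
[claim: Mochizuki2012, status: disputed] -/
theorem uniqueCyclotomeIso_infκ_of_ordHom_of_fixedRoots
    (hcoe : ∀ (g : N.piRat) (a : N.Kratˣ), ((g • a : N.Kratˣ) : N.Krat) = g • (a : N.Krat))
    (hprim : ∀ n : ℕ, 0 < n → ∃ ζ : N.Krat, IsPrimitiveRoot ζ n) (hc : IsExhausted N.Kratˣ S)
    (hfi : ∀ i, (S i).FiniteIndex)
    (hdiv : ∀ (i : ι) (a : N.Kratˣ), a ∈ invariants (A := N.Kratˣ) (S i) →
      (∀ n : ℕ+, ∃ b ∈ invariants (A := N.Kratˣ) (S i), b ^ (n : ℕ) = a) → a = 1)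
    {X : Type*} (ord : X → N.Krat → ℤ)
    (hordmul : ∀ (x : X) (a b : N.Krat), a ≠ 0 → b ≠ 0 → (∀ g : N.piRat, g • a = a) → (∀ g : N.piRat, g • b = b) →
      ord x (a * b) = ord x a + ord x b)
    (hpole : ∀ f' ∈ N.Minfκ, (∀ g : N.piRat, g • f' = f') →
      ∀ x₁ x₂ : X, x₁ ≠ x₂ → ¬ (ord x₁ f' < 0 ∧ ord x₂ f' < 0))
    (hex : ∃ f ∈ N.Minfκ, (∀ g : N.piRat, g • f = f) ∧
      ∃ x₁ x₂ : X, x₁ ≠ x₂ ∧ 0 < ord x₁ f ∧ 0 < ord x₂ f) :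
    UniqueCyclotomeIso
      { μ₁ := cyclotome N.Kratˣ
        μ₂ := cyclotome N.Kratˣ
        H₁ := H1Colimit N.Kratˣ S hS
        H₂ := H1Colimit N.Kratˣ S hS
        im₁ := Set.range fun f : N.infκPair.carrier =>
          kummerMap hS hc (Units.mk0 (f : N.Krat) (N.coe_infκPair_ne_zero f))
        im₂ := Set.range fun f : N.infκPair.carrier =>
          kummerMap hS hc (Units.mk0 (f : N.Krat) (N.coe_infκPair_ne_zero f))
        induced := fun e => H1ColimTwist S hS
          ((Equiv.ofBijective _ (cyclotome.zhatTwist_bijective (R := N.Krat) hprim)).symm e) } :=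
  N.uniqueCyclotomeIso_infκ_of_ordHom S hS hcoe hprim hc hfi
    (fun a b hab => Additive.ofMul.injective (kummerMapHom_injective_of S hS hc hdiv (a₁ := Additive.ofMul a)
      (a₂ := Additive.ofMul b) hab)) ord hordmul hpole hex

end Levels

/-! ### Over the canonical levels (all open normal subgroups of `π₁^rat(†𝒟^⊛)`) and at field level -/

section Canonical

variable (N : NFBridgeRecon.{0})

open scoped Classical in
/-- **E51/L27 at the genuine container over ALL OPEN NORMAL SUBGROUPS of `π₁^rat(†𝒟^⊛)`** ("where `H` ranges over
the open subgroups of `π₁^rat(†𝒟^⊛)`", p. 127): the six system binders of `…_of_ordHom_of_fixedRoots` DISCHARGED by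
abc-iut-w4-d056's canonical level system (`openNormal_antitone`, `isExhausted_openNormal`, `openNormal_finiteIndex`).
Hypotheses: the units action `[MulDistribMulAction π₁^rat K_rat^×]` with `hcoe`, `[RootableBy K_rat^× ℕ]`, `hprim`,
(iv) `hdiv`, (o) `hordmul`, Rmk 3.1.7 (i)/(ii) `hpole`/`hex`.  PROVED. ([IUTchI] Ex 5.1 (v) p.128)
[claim: Mochizuki2012, status: disputed] -/
theorem uniqueCyclotomeIso_infκ_canonical [MulDistribMulAction N.piRat N.Kratˣ] [RootableBy N.Kratˣ ℕ]
    (hcoe : ∀ (g : N.piRat) (a : N.Kratˣ), ((g • a : N.Kratˣ) : N.Krat) = g • (a : N.Krat))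
    (hprim : ∀ n : ℕ, 0 < n → ∃ ζ : N.Krat, IsPrimitiveRoot ζ n)
    (hdiv : ∀ (H : OpenNormalSubgroup N.piRat) (a : N.Kratˣ), a ∈ invariants (A := N.Kratˣ) (H : Subgroup N.piRat) →
      (∀ n : ℕ+, ∃ b ∈ invariants (A := N.Kratˣ) (H : Subgroup N.piRat), b ^ (n : ℕ) = a) → a = 1)
    {X : Type*} (ord : X → N.Krat → ℤ)
    (hordmul : ∀ (x : X) (a b : N.Krat), a ≠ 0 → b ≠ 0 → (∀ g : N.piRat, g • a = a) → (∀ g : N.piRat, g • b = b) →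
      ord x (a * b) = ord x a + ord x b)
    (hpole : ∀ f' ∈ N.Minfκ, (∀ g : N.piRat, g • f' = f') →
      ∀ x₁ x₂ : X, x₁ ≠ x₂ → ¬ (ord x₁ f' < 0 ∧ ord x₂ f' < 0))
    (hex : ∃ f ∈ N.Minfκ, (∀ g : N.piRat, g • f = f) ∧
      ∃ x₁ x₂ : X, x₁ ≠ x₂ ∧ 0 < ord x₁ f ∧ 0 < ord x₂ f) :
    haveI : Nonempty (OpenNormalSubgroup N.piRat)ᵒᵈ :=
      ⟨OrderDual.toDual { toOpenSubgroup := ⊤, isNormal' := Subgroup.normal_of_characteristic ⊤ }⟩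
    UniqueCyclotomeIso
      { μ₁ := cyclotome N.Kratˣ
        μ₂ := cyclotome N.Kratˣ
        H₁ := H1Colimit N.Kratˣ
          (fun i : (OpenNormalSubgroup N.piRat)ᵒᵈ => ((OrderDual.ofDual i : OpenNormalSubgroup N.piRat) : Subgroup N.piRat))
          N.openNormal_antitone
        H₂ := H1Colimit N.Kratˣ
          (fun i : (OpenNormalSubgroup N.piRat)ᵒᵈ => ((OrderDual.ofDual i : OpenNormalSubgroup N.piRat) : Subgroup N.piRat))
          N.openNormal_antitone
        im₁ := Set.range fun f : N.infκPair.carrier =>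
          kummerMap N.openNormal_antitone (N.isExhausted_openNormal hcoe)
            (Units.mk0 (f : N.Krat) (N.coe_infκPair_ne_zero f))
        im₂ := Set.range fun f : N.infκPair.carrier =>
          kummerMap N.openNormal_antitone (N.isExhausted_openNormal hcoe)
            (Units.mk0 (f : N.Krat) (N.coe_infκPair_ne_zero f))
        induced := fun e => H1ColimTwist
          (fun i : (OpenNormalSubgroup N.piRat)ᵒᵈ => ((OrderDual.ofDual i : OpenNormalSubgroup N.piRat) : Subgroup N.piRat))
          N.openNormal_antitone
          ((Equiv.ofBijective _ (cyclotome.zhatTwist_bijective (R := N.Krat) hprim)).symm e) } := by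
  haveI : Nonempty (OpenNormalSubgroup N.piRat)ᵒᵈ :=
    ⟨OrderDual.toDual { toOpenSubgroup := ⊤, isNormal' := Subgroup.normal_of_characteristic ⊤ }⟩
  exact N.uniqueCyclotomeIso_infκ_of_ordHom_of_fixedRoots
    (fun i : (OpenNormalSubgroup N.piRat)ᵒᵈ => ((OrderDual.ofDual i : OpenNormalSubgroup N.piRat) : Subgroup N.piRat))
    N.openNormal_antitone hcoe hprim (N.isExhausted_openNormal hcoe) N.openNormal_finiteIndex
    (fun i a => hdiv (OrderDual.ofDual i) a) ord hordmul hpole hex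

open scoped Classical in
/-- **E51/L27 at the genuine container — FIELD-LEVEL FORM** (the shape of conjunct 1's closer of record
`existsUniqueCoricStructure_infκPair_fieldLevel`, abc-iut-w4-d056 p436822): the units action IS Mathlib's
`Units.mulDistribMulActionRight` (compatible with the field action by `rfl`), rootability of `K_rat^×` is the
field-level side-condition `hrootU` («every nonzero rational function has an `n`-th root for every `n ≥ 1`»,
`K_rat = L̄_C` algebraically closed), and (iv) `hdiv` is read at field level.  Every hypothesis is an elementary
statement about the field `K_rat` with its `π₁^rat`-action, the pseudo-monoid `𝕄^⊛_∞κ` and the order maps: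
`hrootU hprim hdiv ord hordmul hpole hex` — the binders conjunct 1 of `layer5_held_ex51v_v5_fieldLevel` already
carries (its `hroot` gives `hrootU`), NO cyclotome-comparison datum, NO `zμ`/`twist`, NO law (E)/(T)/(D), NO
separate order map `ordC`.  PROVED. ([IUTchI] Ex 5.1 (v) p.128) [claim: Mochizuki2012, status: disputed] -/
theorem uniqueCyclotomeIso_infκ_fieldLevel
    (hrootU : ∀ {n : ℕ}, n ≠ 0 → Function.Surjective fun a : N.Kratˣ => a ^ n)
    (hprim : ∀ n : ℕ, 0 < n → ∃ ζ : N.Krat, IsPrimitiveRoot ζ n)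
    (hdiv : ∀ (H : OpenNormalSubgroup N.piRat) (a : N.Krat), a ≠ 0 → (∀ h : N.piRat, h ∈ H → h • a = a) →
      (∀ n : ℕ+, ∃ b : N.Krat, (∀ h : N.piRat, h ∈ H → h • b = b) ∧ b ^ (n : ℕ) = a) → a = 1)
    {X : Type*} (ord : X → N.Krat → ℤ)
    (hordmul : ∀ (x : X) (a b : N.Krat), a ≠ 0 → b ≠ 0 → (∀ g : N.piRat, g • a = a) → (∀ g : N.piRat, g • b = b) →
      ord x (a * b) = ord x a + ord x b)
    (hpole : ∀ f' ∈ N.Minfκ, (∀ g : N.piRat, g • f' = f') →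
      ∀ x₁ x₂ : X, x₁ ≠ x₂ → ¬ (ord x₁ f' < 0 ∧ ord x₂ f' < 0))
    (hex : ∃ f ∈ N.Minfκ, (∀ g : N.piRat, g • f = f) ∧
      ∃ x₁ x₂ : X, x₁ ≠ x₂ ∧ 0 < ord x₁ f ∧ 0 < ord x₂ f) :
    letI : MulDistribMulAction N.piRat N.Kratˣ := Units.mulDistribMulActionRight
    letI : RootableBy N.Kratˣ ℕ := rootableByOfPowLeftSurj N.Kratˣ ℕ hrootU
    haveI : Nonempty (OpenNormalSubgroup N.piRat)ᵒᵈ :=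
      ⟨OrderDual.toDual { toOpenSubgroup := ⊤, isNormal' := Subgroup.normal_of_characteristic ⊤ }⟩
    UniqueCyclotomeIso
      { μ₁ := cyclotome N.Kratˣ
        μ₂ := cyclotome N.Kratˣ
        H₁ := H1Colimit N.Kratˣ
          (fun i : (OpenNormalSubgroup N.piRat)ᵒᵈ => ((OrderDual.ofDual i : OpenNormalSubgroup N.piRat) : Subgroup N.piRat))
          N.openNormal_antitone
        H₂ := H1Colimit N.Kratˣ
          (fun i : (OpenNormalSubgroup N.piRat)ᵒᵈ => ((OrderDual.ofDual i : OpenNormalSubgroup N.piRat) : Subgroup N.piRat))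
          N.openNormal_antitone
        im₁ := Set.range fun f : N.infκPair.carrier =>
          kummerMap N.openNormal_antitone (N.isExhausted_openNormal fun _ _ => rfl)
            (Units.mk0 (f : N.Krat) (N.coe_infκPair_ne_zero f))
        im₂ := Set.range fun f : N.infκPair.carrier =>
          kummerMap N.openNormal_antitone (N.isExhausted_openNormal fun _ _ => rfl)
            (Units.mk0 (f : N.Krat) (N.coe_infκPair_ne_zero f))
        induced := fun e => H1ColimTwist
          (fun i : (OpenNormalSubgroup N.piRat)ᵒᵈ => ((OrderDual.ofDual i : OpenNormalSubgroup N.piRat) : Subgroup N.piRat))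
          N.openNormal_antitone
          ((Equiv.ofBijective _ (cyclotome.zhatTwist_bijective (R := N.Krat) hprim)).symm e) } := by
  letI : MulDistribMulAction N.piRat N.Kratˣ := Units.mulDistribMulActionRight
  letI : RootableBy N.Kratˣ ℕ := rootableByOfPowLeftSurj N.Kratˣ ℕ hrootU
  exact N.uniqueCyclotomeIso_infκ_canonical (fun _ _ => rfl) hprim
    (fun H a ha hroots => N.hdiv_units_of_field hdiv H a ha hroots) ord hordmul hpole hex

/-- The field-level rootability side-condition `hrootU` from conjunct 1's `hroot` («every nonzero rational function
has an `n`-th root for every `n ≥ 1`»). ([IUTchI] Ex 5.1 (v) p.127) [claim: Mochizuki2012, status: disputed] -/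
theorem units_pow_surjective_of_roots
    (hroot : ∀ a : N.Krat, a ≠ 0 → ∀ n : ℕ, 0 < n → ∃ b : N.Krat, b ^ n = a) {n : ℕ} (hn : n ≠ 0) :
    Function.Surjective fun a : N.Kratˣ => a ^ n := fun a => by
  obtain ⟨b, hb⟩ := hroot (a : N.Krat) a.ne_zero n (Nat.pos_of_ne_zero hn)
  have hb0 : b ≠ 0 := fun h0 => a.ne_zero (by rw [← hb, h0, zero_pow hn])
  exact ⟨Units.mk0 b hb0, Units.ext (by rw [Units.val_pow_eq_pow_val, Units.val_mk0, hb])⟩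

end Canonical

end NFBridgeRecon

end Literature.IUT.HodgeTheaters
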